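import Summits.HubbardSuperconductivity.HubbardSuperconductivity.Theorems.CooperPairDMottWalkCooperPairDMottPlaquetteGCWindowSectorBounds
import HarnessLib

/-!
# Route `LevyLogBootstrap` / `AnisotropyChord`, crux `DressHalfFilled` (stmt-HubbardSuperconductivity-8148), stub 1
# `stub_plaquetteData`, certificate (W1) at `U = 2`: the `(N↑, N↓) = (2, 1)` sector floor of the plaquette

Support file (`--supports stmt-HubbardSuperconductivity-8148`). The certified evaluation of Kato's two-plaquette kernel
at `U = 2` (the (W1) window of the plaquette data) needs a lower bound on the `2 × 2` Hubbard plaquette Hamiltonian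
`plaquetteHamiltonian 2` on the three-electron spin sector `(N↑, N↓) = (2, 1)` (the intermediate states of a single
inter-plaquette hop out of the `(2,2) ⊗ (1,1)` / `(1,1) ⊗ (1,1)` manifolds). The kernel-checked Gram certificates of
route `CooperPairDMottWalk` (`CooperPairDMottWalk.plaq21_lb`, the `(2,1)` half-interval chord on `U ∈ [2, 4]`:
`((4−U)/2 · (−3.211) + (U−2)/2 · (−2.754)) ‖v‖² ≤ Re⟨v, H(U) v⟩`) give at `U = 2` exactly the registered floor
`−3.211 ‖v‖² ≤ Re⟨v, H(2) v⟩` (`plaquette_floor21_two`). The registered sub-goal `dressHalfFilled_w1_floor21Two`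
(signature verbatim as registered on the item) is the closed form.

References: W.-F. Tsai, S. A. Kivelson, PRB 73 (2006) 214510, Table I [TsaiKivelson2006]; H. Yao, W.-F. Tsai,
S. A. Kivelson, PRB 76 (2007) 161104(R), p. 4 [YaoTsaiKivelson2007]. No definition and no named fact is introduced;
the statement is a [folklore] specialisation of a kernel-checked certificate.
-/

set_option linter.dupNamespace false

noncomputable section

namespace Summit.HubbardSuperconductivity.HubbardSuperconductivity.Theorems.LevyLogBootstrap

open Matrix Literature.MathematicalPhysics.QuantumLattice
open Summit.HubbardSuperconductivity.HubbardSuperconductivity.Theorems.CooperPairDMottWalk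

/-- **The `(2,1)` sector floor of the plaquette at `U = 2`**: `−3.211 ‖v‖² ≤ Re⟨v, H(2) v⟩` for every plaquette
vector `v` with two up and one down electrons (the `U = 2` end of `CooperPairDMottWalk.plaq21_lb`).
[cite: TsaiKivelson2006, Table I] -/
theorem plaquette_floor21_two (v : Fock (Orb PlaquetteSite)) (hv : IsInSector 2 1 v) :
    (-3211 / 1000 : ℝ) * (star v ⬝ᵥ v).re ≤ (star v ⬝ᵥ (plaquetteHamiltonian 2 *ᵥ v)).re := by
  have h := plaq21_lb (U := 2) (by norm_num) (by norm_num) v hv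
  have hc : ((4 - 2) / 2 * (-3211 / 1000) + (2 - 2) / 2 * (-2754 / 1000) : ℝ) = -3211 / 1000 := by norm_num
  rw [hc] at h
  exact h

/-! ### Registered form -/

set_option linter.style.longLine false in
/-- **Registered sub-goal `dressHalfFilled_w1_floor21Two`** (closed form, signature verbatim as registered on the crux
item stmt-HubbardSuperconductivity-8148): the `(2,1)` sector floor `−3.211` of `plaquetteHamiltonian 2`.
[cite: TsaiKivelson2006, Table I] -/
theorem dressHalfFilled_w1_floor21Two : ∀ v : Fock (Orb PlaquetteSite), IsInSector 2 1 v → (-3211 / 1000 : ℝ) * (star v ⬝ᵥ v).re ≤ (star v ⬝ᵥ (plaquetteHamiltonian 2 *ᵥ v)).re :=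
  fun v hv => plaquette_floor21_two v hv

end Summit.HubbardSuperconductivity.HubbardSuperconductivity.Theorems.LevyLogBootstrap

end
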